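import Mathlib
import Summits.ValiantsHypothesis.ValiantsHypothesis.Theorems.BarrierLeverDefinableEquationsCoefficientFunctionCrux
import Summits.ValiantsHypothesis.ValiantsHypothesis.Theorems.BarrierLeverIntegerBoxVanishingTransfer

/-!
# Crux `BarrierLever.DefinableEquations` (stmt-8745) / item `SingleSizeEquations` (stmt-8749) —
# the DISCRETE normal form: explicit coefficient functions tested on the INTEGER SLICE only
# (coefficient-axis collapse of item 20033 × the explicit-coefficient normal form; val-np-p5 g7)

Item 20033 `IntegerBoxVanishingTransfer` (FSV Lemmas 13–14 over Raz's universal circuit; tree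
`IntSlice.vanishes_of_vanishes_on_intBox`) is stated for level-`a` DISTINGUISHERS, but its proof
uses only the DEGREE bound.  Here it is re-run for an arbitrary polynomial of bounded degree
(`IntSliceExplicit.vanishes_of_vanishes_on_intBox_of_degree`) and for top-supported equations
(`…_top`), and combined with `definableEquations_iff_explicitCoefficients`:

**`definableEquations_iff_explicitCoefficients_intBox`** — the crux holds iff for some `c`, for
every `b`, eventually in `n`, there is a NONZERO `E ∈ ℂ[topMonomials n]` with `N^c`-explicit
coefficient function (Boolean-cube marginal of one bits-only polynomial `Q₀`, exponents `≤ D ≤ N^c`)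
vanishing at the top component of every member of `SmallCircuits ℂ n (5b+23)` whose coefficients
are INTEGERS of absolute value `≤ IntSlice.bnd n b ((N^(c+1) + 1)(n + 1))` (bit-length
`O(c n² + b n log n)`).

Both sides of the equation test are now finite/discrete data at each `n`: finitely many integer
test polynomials of polynomial bit-length against one poly(`N`)-size description of the coefficient
function.  (The class `SmallCircuits` is still defined by complex circuits; only the test SET is
discrete.)  Reductions/normal forms only: the crux stays OPEN (Chatterjee–Tengse 2023 §1.3 dir. 2)
and nothing here bears on `VP ≠ VNP`.  No definitions, no named facts.
Refs: Forbes–Shpilka–Volk 2018, Lemmas 13–14; Bürgisser 2000, Prop. 2.20; CT23 §1.3.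
-/

set_option linter.dupNamespace false

noncomputable section

namespace Summit.ValiantsHypothesis.ValiantsHypothesis.Theorems.BarrierLeverDefinableEquations

open MvPolynomial Literature.Computability.AlgebraicComplexity
open Literature.Barriers.ValiantsHypothesis
open Summit.ValiantsHypothesis.ValiantsHypothesis.Theorems.BarrierLever.IntSlice
open Summit.ValiantsHypothesis.ValiantsHypothesis.Theorems.BarrierLever.SuccinctHittingSetsForVP
open Summit.ValiantsHypothesis.ValiantsHypothesis.Theorems.BarrierLever.SuccinctHittingSetsForVP
open JointGen
open scoped BigOperators

namespace IntSliceExplicit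

/-- **Coefficient-axis collapse, seed form, DEGREE-ONLY version** of
`IntSlice.vanishes_of_vanishes_on_intSeedGrid`: a polynomial `D` of degree `≤ dg` in the coefficient
variables vanishing at `gen n b (y)` for every integer seed `|y_i| ≤ h`, `dg (2n+1) ≤ 2h`,
vanishes on all of `SmallCircuits ℂ n b` (no size bound on `D` is needed).
[cite: ForbesShpilkaVolk2018, Lemmas 13–14] -/
theorem vanishes_of_vanishes_on_intSeedGrid_of_degree {n b dg : ℕ}
    {D : MvPolynomial (degLEMonomials n) ℂ} (hdeg : D.totalDegree ≤ dg) {h : ℕ}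
    (hh : dg * (2 * n + 1) ≤ 2 * h)
    (hgrid : ∀ y : Fin (q n b) → ℤ, (∀ i, |y i| ≤ h) →
      eval (fun m => eval (fun i => (y i : ℂ)) (gen n b m)) D = 0) :
    ∀ f ∈ SmallCircuits ℂ n b, eval (coeffVector (degLEMonomials n) f) D = 0 := by
  have hzero : aeval (gen n b) D = 0 := by
    refine eq_zero_of_eval_int_grid _ h ?_ (fun y hy => ?_)
    · calc (aeval (gen n b) D).totalDegree
          ≤ D.totalDegree * (2 * n + 1) := totalDegree_aeval_gen_le D
        _ ≤ dg * (2 * n + 1) := Nat.mul_le_mul_right _ hdeg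
        _ ≤ 2 * h := hh
    · rw [← Generator.eval_point_eq]; exact hgrid y hy
  intro f hf
  obtain ⟨y, hy⟩ := exists_seed_of_mem hf
  have hpt : coeffVector (degLEMonomials n) f = fun m => eval y (gen n b m) :=
    funext fun m => by rw [coeffVector_apply, hy m]
  rw [hpt, Generator.eval_point_eq, hzero, map_zero]

/-- **Coefficient-axis collapse, box form, DEGREE-ONLY**: for `n ≥ 21876·2^(5b+21)+1`, a polynomial
`D` of degree `≤ dg` in the coefficient variables vanishing on the members of
`SmallCircuits ℂ n (5b+23)` with INTEGER coefficients of absolute value `≤ bnd n b ((dg+1)(n+1))`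
vanishes on all of `SmallCircuits ℂ n b`. [cite: ForbesShpilkaVolk2018, Lemmas 13–14] -/
theorem vanishes_of_vanishes_on_intBox_of_degree {n b dg : ℕ}
    (hn : 21876 * 2 ^ (5 * b + 21) + 1 ≤ n) {D : MvPolynomial (degLEMonomials n) ℂ}
    (hdeg : D.totalDegree ≤ dg)
    (hvan : ∀ f ∈ SmallCircuits ℂ n (5 * b + 23),
      f ∈ intBox n (bnd n b ((dg + 1) * (n + 1))) →
        eval (coeffVector (degLEMonomials n) f) D = 0) :
    ∀ f ∈ SmallCircuits ℂ n b, eval (coeffVector (degLEMonomials n) f) D = 0 := by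
  have hn1 : 1 ≤ n := le_trans (Nat.le_add_left 1 _) hn
  have hh : 1 ≤ (dg + 1) * (n + 1) := Nat.mul_pos (Nat.succ_pos _) (Nat.succ_pos _)
  refine vanishes_of_vanishes_on_intSeedGrid_of_degree hdeg (h := (dg + 1) * (n + 1))
    (by nlinarith) (fun y hy => ?_)
  have hcv : (fun m => eval (fun i => (y i : ℂ)) (gen n b m)) =
      coeffVector (degLEMonomials n) (aeval (Sum.elim X fun j => C ((y j : ℂ))) (gamma n b)) := by
    funext m
    rw [coeffVector_apply, coeff_seedSpec_gamma]
  rw [hcv]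
  exact hvan _ (seedSpec_mem_smallCircuits hn _) (seedSpec_mem_intBox hn1 y hh hy)

/-- **The same for top-supported equations**: a polynomial `E` in the top coefficient variables with
exponents `≤ D` (so `deg E ≤ N · D`, `N = C(2n,n)`), vanishing at the top component of every member
of `SmallCircuits ℂ n (5b+23)` with integer coefficients of absolute value
`≤ bnd n b ((N D + 1)(n+1))`, vanishes at the top component of every `f ∈ SmallCircuits ℂ n b`.
[cite: ForbesShpilkaVolk2018, Lemmas 13–14] -/
theorem vanishes_of_vanishes_on_intBox_top {n b D : ℕ} (hn : 21876 * 2 ^ (5 * b + 21) + 1 ≤ n)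
    {E : MvPolynomial ↥(topMonomials n) ℂ} (hsupp : ∀ m ∈ E.support, ∀ e, m e ≤ D)
    (hvan : ∀ f ∈ SmallCircuits ℂ n (5 * b + 23),
      f ∈ intBox n (bnd n b ((Nat.choose (2 * n) n * D + 1) * (n + 1))) →
        eval (fun e : topMonomials n => coeff (e : Fin n →₀ ℕ) f) E = 0) :
    ∀ f ∈ SmallCircuits ℂ n b,
      eval (fun e : topMonomials n => coeff (e : Fin n →₀ ℕ) f) E = 0 := by
  classical
  haveI : Fintype (topMonomials n) := (Finsupp.finite_of_degree_eq (σ := Fin n) n).fintype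
  -- degree of `E`: every exponent `≤ D`, at most `N` variables
  have hdeg : E.totalDegree ≤ Nat.choose (2 * n) n * D := by
    refine Finset.sup_le fun m hm => ?_
    change (m.sum fun _ e => e) ≤ _
    calc (m.sum fun _ e => e) = ∑ e ∈ m.support, m e := rfl
      _ ≤ ∑ e : ↥(topMonomials n), m e :=
          Finset.sum_le_sum_of_subset_of_nonneg (Finset.subset_univ _) fun _ _ _ => Nat.zero_le _
      _ ≤ ∑ _e : ↥(topMonomials n), D := Finset.sum_le_sum fun e _ => hsupp m hm e
      _ = Fintype.card ↥(topMonomials n) * D := by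
          rw [Finset.sum_const, Finset.card_univ, smul_eq_mul]
      _ ≤ Nat.choose (2 * n) n * D :=
          Nat.mul_le_mul_right _ (SelGadget.card_topMonomials_le n)
  -- transport to the full coefficient variables along `topIncl`
  have key := vanishes_of_vanishes_on_intBox_of_degree hn (D := rename (topIncl n) E)
    ((totalDegree_rename_le _ _).trans hdeg) (fun f hf hbox => by
      rw [eval_rename]
      exact hvan f hf hbox)
  intro f hf
  have h := key f hf
  rwa [eval_rename] at h

end IntSliceExplicit

open IntSliceExplicit

/-- **DISCRETE NORMAL FORM of the crux.**  `DefinableEquations` holds iff for some `c`, for every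
`b`, eventually in `n`, there are `D, r ≤ N^c`, a bits-only `Q₀` with `L(Q₀), deg Q₀ ≤ N^c`, and a
NONZERO `E ∈ ℂ[topMonomials n]` with exponents `≤ D` and coefficient function
`coeff_m E = ∑_w Q₀(oneHot m, w)`, vanishing at the top component of every member of
`SmallCircuits ℂ n (5b+23)` whose coefficients are INTEGERS of absolute value
`≤ bnd n b ((N^(c+1) + 1)(n+1))`.  (`→`: `definableEquations_iff_explicitCoefficients` at `5b+23`;
`←`: the degree-only integer-box transfer, then the same iff.)
[cite: ForbesShpilkaVolk2018, Lemmas 13–14] -/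
theorem definableEquations_iff_explicitCoefficients_intBox :
    Summit.ValiantsHypothesis.ValiantsHypothesis.Theses.BarrierLever.DefinableEquations ↔
    ∃ c : ℕ, ∀ b : ℕ, ∃ n₀ : ℕ, ∀ n ≥ n₀,
      ∃ D r : ℕ, D ≤ (Nat.choose (2 * n) n) ^ c ∧ r ≤ (Nat.choose (2 * n) n) ^ c ∧
      ∃ Q₀ : MvPolynomial ((↥(topMonomials n) × Fin (D + 1)) ⊕ Fin r) ℂ,
        complexity Q₀ ≤ (Nat.choose (2 * n) n) ^ c ∧
        Q₀.totalDegree ≤ (Nat.choose (2 * n) n) ^ c ∧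
        ∃ E : MvPolynomial ↥(topMonomials n) ℂ, E ≠ 0 ∧
          (∀ f ∈ SmallCircuits ℂ n (5 * b + 23),
            f ∈ intBox n (bnd n b (((Nat.choose (2 * n) n) ^ (c + 1) + 1) * (n + 1))) →
            eval (fun e : topMonomials n => coeff (e : Fin n →₀ ℕ) f) E = 0) ∧
          (∀ m ∈ E.support, ∀ e, m e ≤ D) ∧
          ∀ m : ↥(topMonomials n) →₀ ℕ, (∀ e, m e ≤ D) → coeff m E =
            ∑ w : Fin r → Bool, eval (fun x => if Sum.elim
              (fun p : ↥(topMonomials n) × Fin (D + 1) => decide (m p.1 = (p.2 : ℕ))) w x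
              then (1 : ℂ) else 0) Q₀ := by
  rw [definableEquations_iff_explicitCoefficients]
  constructor
  · rintro ⟨c, hc⟩
    refine ⟨c, fun b => ?_⟩
    obtain ⟨n₀, hn₀⟩ := hc (5 * b + 23)
    refine ⟨n₀, fun n hn => ?_⟩
    obtain ⟨D, r, hD, hr, Q₀, hQc, hQd, E, hE0, hvan, hsupp, hcoeff⟩ := hn₀ n hn
    exact ⟨D, r, hD, hr, Q₀, hQc, hQd, E, hE0, fun f hf _ => hvan f hf, hsupp, hcoeff⟩
  · rintro ⟨c, hc⟩
    refine ⟨c, fun b => ?_⟩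
    obtain ⟨n₀, hn₀⟩ := hc b
    refine ⟨max n₀ (21876 * 2 ^ (5 * b + 21) + 1), fun n hn => ?_⟩
    obtain ⟨D, r, hD, hr, Q₀, hQc, hQd, E, hE0, hvan, hsupp, hcoeff⟩ :=
      hn₀ n (le_trans (le_max_left _ _) hn)
    have hn' : 21876 * 2 ^ (5 * b + 21) + 1 ≤ n := le_trans (le_max_right _ _) hn
    refine ⟨D, r, hD, hr, Q₀, hQc, hQd, E, hE0, ?_, hsupp, hcoeff⟩
    refine vanishes_of_vanishes_on_intBox_top hn' hsupp fun f hf hbox => hvan f hf ?_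
    refine intBox_mono ?_ hbox
    unfold bnd
    have hND : Nat.choose (2 * n) n * D + 1 ≤ (Nat.choose (2 * n) n) ^ (c + 1) + 1 := by
      rw [pow_succ']
      exact Nat.succ_le_succ (Nat.mul_le_mul_left _ hD)
    gcongr

end Summit.ValiantsHypothesis.ValiantsHypothesis.Theorems.BarrierLeverDefinableEquations

end
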